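import Summits.Ventures.CertifiedManyBodySolver.Rows.HubbardChainMPSRaw6TrNodesNszb
import Summits.Ventures.CertifiedManyBodySolver.Transport.MPSPrimalRaw4SrotSz
import HarnessLib

/-!
# Ventures/CertifiedManyBodySolver — Rows/HubbardChainMPSRaw4TrNodesSz.lean: the `jw-srot` RAWLOW node with raw block `ρ₄` and ONE STAGGERED
# CHARGE COMPONENT (FORMAT-ksdn v0.5 `mps-rawlow` + v0.6 AMENDMENT 2 'N-FREE staggered-only', χ8 one-label `S̃z`: `m₀ = 5`, injection `W₃`,
# `lmax_psd` trace bounds, one involutive bond label) and its solver-free edges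

HONEST FRAMING: first certified bounds; not a superconductivity verdict; every number certified or labelled float.

Speedrun cell sr-mbsolver / programme hubbard-alg, LIT team (lit-1 gen-21), T3‴ of the design note HOME/sr-mbsolver-lit-1/HANDOFF.md (gen-20, 14:15Z (c))
— the CLAIM-NODE SHAPE for the BY-VALUE Lean cells of the χ8 one-label `S̃z` ('N-FREE') certificates (CERTIFIED #455 (8, ½), #456 (4, ½), #459 (8, ¾),
#460 (8, ⅞) — the GRID-0823 r205 M1 TIER 1 / LAW-E rider doped chain lowers of record; D = 8, `relax m0 = 5, k = 4`). It is
`Rows/HubbardChainMPSRaw6TrNodesNszb.lean` (lit-1 g18) with: raw head block `ρ₄ : Op (PolySite {-1,…,2}) 4` (coordinates `chainWindowFourEquiv : Fin 4 ≃ {-1,…,2}`,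
`i ↦ i − 1`), rows E5L / E5R through `W₃ = cgMap (castTensor A) 3`, compressed levels `ω₅ … ω_N`; ONE bond charge `qb : ℕ → Fin D → ℤ` read per bond
POSITION (the staggered spin charge `(−1)^x·cm·([↑ ∈ occ] − [↓ ∈ occ])`, `hubbardSzQeff`; the instance's involutive bond rule `u_b = κ − u_a − m(s)` is the
case `qb x a = (−1)^x (2u_a − κ)`, `cm = 2`, `MPSCoarseGraining.covariantAt_of_involutive`), `ω`-tags `cgTagAt (hubbardSzQeff cm) qb 0 (m−2)`; the
STAGGERED-SPIN sector zeros of `ρ₄` and NO total-occupation sectors (the particle number is free; the density enters only through the density row).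
Edges: `.mono`; `MPSChainKSDNRaw4TrNodeSz.ltiChainKSDNNodeSrotNszb` (via `Transport.ksdnSrotNszbClaim_of_mpsRaw4SrotSzTrClaim`) to the EXISTING window
node with staggered sectors `LTIChainKSDNNodeSrotNszb` (`Rows/HubbardChainMPSRaw6TrNodesNszb.lean`; its occupation row is an unused hypothesis), hence
`.ltiChainKSDNNode` (via `LTIChainKSDNNodeSrotNszb.ltiChainKSDNNode` = `Transport.ksdnClaim_of_srotNszbClaim`, no twirl), `.m1EnergyLowerRow`,
`.m1DopedEnergyLowerRow`. The plain window node of the window-level files (`LTIChainKSDNNodeSrot`, lit-4 p380292 / rows459_460) implies the same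
`LTIChainKSDNNodeSrotNszb` (`LTIChainKSDNNodeSrot.nszb`) — the direction that holds between the two levels. No `sorry`, no new axiom, no named fact; the
node is a `def … : Prop` taken as hypothesis by the Certificates/ instances.
[cite: KullEtAl2024, §2.5 eq. (TNfullRelax5), §3.3, §4.2 eq. (relaxLocTIn), §6.2] [cite: ArakiMoriya2003, §4.1] [cite: EsslerEtAl2005, §12.3.4]
-/

noncomputable section

open Matrix Complex Filter Topology
open scoped ComplexOrder Kronecker BigOperators MatrixOrder
open Literature.Probability.LatticeModels
open Literature.MathematicalPhysics.QuantumLattice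
open Literature.MathematicalPhysics.QuantumLattice.HubbardWave0
open Literature.MathematicalPhysics.QuantumLattice.ThermodynamicLimit
open Literature.MathematicalPhysics.QuantumLattice.JordanWigner
open Literature.MathematicalPhysics.QuantumManyBody.StateRelaxation
open Literature.MathematicalPhysics.QuantumLattice.MPSCoarseGraining
open Literature.Computability.QuantumComplexity (traceLeft traceRight)
open Summit.Ventures.CertifiedManyBodySolver.Transport

namespace Summit.Ventures.CertifiedManyBodySolver

/-! ## §A  The coordinates of the four-site raw window and the staggered charge -/

section Data

/-- **The coordinates of the four-site raw window**: `Fin 4 ≃ {-1, 0, 1, 2}`, `i ↦ i − 1` (the instance's raw block `rho4` sites `1…4` are the tree's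
sites `-1…2`). [folklore] -/
def chainWindowFourEquiv : Fin 4 ≃ PolySite (chainWindow (-1) 2) where
  toFun i := PolySite.pt (fun _ => ((i : ℕ) : ℤ) - 1) (by
    rw [mem_chainWindow]
    have hi := i.2
    show -1 ≤ ((i : ℕ) : ℤ) - 1 ∧ ((i : ℕ) : ℤ) - 1 ≤ 2
    omega)
  invFun y := ⟨(ofLex y.1 0 + 1).toNat, by
    have h := mem_chainWindow.1 (PolySite.ofLex_mem y)
    have h1 : ((ofLex y.1 0 + 1).toNat : ℤ) = ofLex y.1 0 + 1 := Int.toNat_of_nonneg (by omega)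
    omega⟩
  left_inv i := Fin.ext (by
    show ((((i : ℕ) : ℤ) - 1) + 1).toNat = (i : ℕ)
    rw [sub_add_cancel, Int.toNat_natCast])
  right_inv y := polySite_eq_of_coord_eq (by
    have h := mem_chainWindow.1 (PolySite.ofLex_mem y)
    have h1 : ((ofLex y.1 0 + 1).toNat : ℤ) = ofLex y.1 0 + 1 := Int.toNat_of_nonneg (by omega)
    show (((ofLex y.1 0 + 1).toNat : ℕ) : ℤ) - 1 = ofLex y.1 0
    omega)

/-- The coordinates of `chainWindowFourEquiv`: `i ↦ i − 1`. [folklore] -/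
@[simp] theorem chainWindowFourEquiv_coord (i : Fin 4) : ofLex (chainWindowFourEquiv i).1 0 = ((i : ℕ) : ℤ) - 1 := rfl

/-- **The site charge of the one-label `S̃z` tensors, read at bond/site POSITION `x`**: the staggered spin charge
`(−1)^x·cm·([↑ ∈ occ s] − [↓ ∈ occ s])` (FORMAT-ksdn v0.6 AMENDMENT 2 with `cm = 2`: `qs x s = (−1)^x · 2 m(s)`, `m = (0, +1, −1, 0)`); = component 1 of
`hubbardNszbQeff`. [cite: KullEtAl2024, §3.3] -/
def hubbardSzQeff (cm : ℤ) (x : ℕ) (s : Fin 4) : ℤ :=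
  (-1 : ℤ) ^ x * cm * ((if (0 : Fin 2) ∈ siteOcc s then 1 else 0 : ℤ) - (if (1 : Fin 2) ∈ siteOcc s then 1 else 0 : ℤ))

/-- Unfolding `hubbardSzQeff`. [cite: KullEtAl2024, §3.3] -/
theorem hubbardSzQeff_apply (cm : ℤ) (x : ℕ) (s : Fin 4) : hubbardSzQeff cm x s =
    (-1 : ℤ) ^ x * cm * ((if (0 : Fin 2) ∈ siteOcc s then 1 else 0 : ℤ) - (if (1 : Fin 2) ∈ siteOcc s then 1 else 0 : ℤ)) := rfl

/-- `hubbardSzQeff` is component 1 of the pair charge `hubbardNszbQeff`. [cite: KullEtAl2024, §3.3] -/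
theorem hubbardNszbQeff_snd (cb ca cm : ℤ) (x : ℕ) (s : Fin 4) : (hubbardNszbQeff cb ca cm x s).2 = hubbardSzQeff cm x s := rfl

end Data

/-! ## §B  The node predicate (window `{-1, …, n+1}` of `N = n + 3 ≥ 5` sites, raw block `ρ₄`, bond dimension `D`, model `hubbard_jwsrot(U)`, `t = 1`) -/

section Nodes

/-- **`jw-srot` `relax = mps-rawlow(N, D, A)` node with raw block `ρ₄`, TRACE BOUNDS and ONE STAGGERED CHARGE COMPONENT, `ksdn-inst/1` v0.5 + v0.6
AMENDMENT 2 'N-FREE staggered-only' form** (the `hclaim` of `Transport.ksdnSrotNszbClaim_of_mpsRaw4SrotSzTrClaim` at `t = 1` with rational data and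
`qs = hubbardSzQeff cm`): for all variables `ρ₄ : Op (PolySite {-1,…,2}) 4` and `ω m` (`5 ≤ m ≤ n + 3`, indexed `(s_L, (a,b), s_R)`), IF `ρ₄ ⪰ 0`,
`tr ρ₄ = 1`, the LTI row `tr_{-1} ρ₄ = tr_{2} ρ₄`, the STAGGERED-SPIN sector zeros (NO occupation sectors: the particle number is free), the total
density of site `-1` equal to `ν`, real entries, `|ρ₄| ≤ 1`; rows E5L / E5R (through `chainWindowFourEquiv`, `W₃ = cgMap (castTensor A) 3`), E_mL /
E_mR for `6 ≤ m ≤ n+3`; `ω_m ⪰ 0`, sector zeros for the site-indexed tags `cgTagAt (hubbardSzQeff cm) qb 0 (m−2)`, real entries, `|ω_m| ≤ B m` AND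
`Re tr ω_m ≤ B m` (`5 ≤ m ≤ n+3`) — THEN `lo ≤ Re tr(toSpin(U n_{-1↑}n_{-1↓} − Σ_σ (c†_{-1σ} c_{0σ̄} + c†_{0σ̄} c_{-1σ})) ρ₄)`. By-name audit token:
predicate NAME + `(U, n + 3 = the file's n, D, ν, lo)` + the tables `A`, `qb` (per bond index AND position parity: `qb x a = (−1)^x (2u_a − κ)`), `cm`,
`B m` (= `bounds.levels[m].r`, m ≥ 5). [cite: KullEtAl2024, §2.5 eq. (TNfullRelax5), §3.3, §4.2 eq. (relaxLocTIn), §6.2] -/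
def MPSChainKSDNRaw4TrNodeSz (U : ℝ) (n D : ℕ) (A : Fin 4 → Matrix (Fin D) (Fin D) ℚ) (qb : ℕ → Fin D → ℤ) (cm : ℤ)
    (B : ℕ → ℚ) (ν lo : ℚ) : Prop :=
  ∀ (ρ₄ : Op (PolySite (chainWindow (-1) 2)) 4)
    (ω : ℕ → Matrix (Fin 4 × ((Fin D × Fin D) × Fin 4)) (Fin 4 × ((Fin D × Fin D) × Fin 4)) ℂ),
    ρ₄.PosSemidef → ρ₄.trace = 1 →
    spinPartialTrace ((PolySite.affEmb 1 (unitVec 0) (chainWindow (-1) 1)).trans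
        (PolySite.incl affShiftSet_chainWindow_one_subset_two)) ρ₄ =
      spinPartialTrace (PolySite.incl chainWindow_one_subset_two) ρ₄ →
    (∀ k k' : TensorIndex (PolySite (chainWindow (-1) 2)) 4,
      (∑ y : PolySite (chainWindow (-1) 2), (if Odd (ofLex y.1 0) then (-1 : ℤ) else 1) *
          ((if (0 : Fin 2) ∈ siteOcc (k y) then 1 else 0 : ℤ) - (if (1 : Fin 2) ∈ siteOcc (k y) then 1 else 0 : ℤ))) ≠
        (∑ y : PolySite (chainWindow (-1) 2), (if Odd (ofLex y.1 0) then (-1 : ℤ) else 1) *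
          ((if (0 : Fin 2) ∈ siteOcc (k' y) then 1 else 0 : ℤ) - (if (1 : Fin 2) ∈ siteOcc (k' y) then 1 else 0 : ℤ))) →
      ρ₄ k k' = 0) →
    ((toSpin (nAt (-unitVec 0) neg_unitVec_mem_chainWindow_two 0 + nAt (-unitVec 0) neg_unitVec_mem_chainWindow_two 1) *
        ρ₄).trace).re = ((ν : ℚ) : ℝ) →
    (∀ k k' : TensorIndex (PolySite (chainWindow (-1) 2)) 4, starRingEnd ℂ (ρ₄ k k') = ρ₄ k k') →
    (∀ k k' : TensorIndex (PolySite (chainWindow (-1) 2)) 4, ‖ρ₄ k k'‖ ≤ 1) →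
    traceLeft (ω 5) = (cgMap (castTensor A) 3 ⊗ₖ (1 : Matrix (Fin 4) (Fin 4) ℂ)) *
        (ρ₄.submatrix (Equiv.arrowCongr chainWindowFourEquiv (Equiv.refl (Fin 4)))
            (Equiv.arrowCongr chainWindowFourEquiv (Equiv.refl (Fin 4)))).submatrix
          ((Equiv.prodComm _ _).trans (Fin.snocEquiv fun _ => Fin 4))
          ((Equiv.prodComm _ _).trans (Fin.snocEquiv fun _ => Fin 4)) *
      (cgMap (castTensor A) 3 ⊗ₖ (1 : Matrix (Fin 4) (Fin 4) ℂ))ᴴ →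
    traceRight ((ω 5).submatrix (Equiv.prodAssoc _ _ _) (Equiv.prodAssoc _ _ _)) =
      ((1 : Matrix (Fin 4) (Fin 4) ℂ) ⊗ₖ cgMap (castTensor A) 3) *
        (ρ₄.submatrix (Equiv.arrowCongr chainWindowFourEquiv (Equiv.refl (Fin 4)))
            (Equiv.arrowCongr chainWindowFourEquiv (Equiv.refl (Fin 4)))).submatrix
          (Fin.consEquiv fun _ => Fin 4) (Fin.consEquiv fun _ => Fin 4) *
      ((1 : Matrix (Fin 4) (Fin 4) ℂ) ⊗ₖ cgMap (castTensor A) 3)ᴴ →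
    (∀ k, k + 6 ≤ n + 3 → traceLeft (ω (k + 6)) =
      (leftMap (castTensor A) ⊗ₖ (1 : Matrix (Fin 4) (Fin 4) ℂ)) *
        (ω (k + 5)).submatrix (Equiv.prodAssoc _ _ _) (Equiv.prodAssoc _ _ _) *
      (leftMap (castTensor A) ⊗ₖ (1 : Matrix (Fin 4) (Fin 4) ℂ))ᴴ) →
    (∀ k, k + 6 ≤ n + 3 → traceRight ((ω (k + 6)).submatrix (Equiv.prodAssoc _ _ _) (Equiv.prodAssoc _ _ _)) =
      ((1 : Matrix (Fin 4) (Fin 4) ℂ) ⊗ₖ rightMap (castTensor A)) * ω (k + 5) *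
      ((1 : Matrix (Fin 4) (Fin 4) ℂ) ⊗ₖ rightMap (castTensor A))ᴴ) →
    (∀ k, k + 5 ≤ n + 3 → (ω (k + 5)).PosSemidef) →
    (∀ k, k + 5 ≤ n + 3 → ∀ i j,
      cgTagAt (hubbardSzQeff cm) qb 0 (k + 3) i ≠ cgTagAt (hubbardSzQeff cm) qb 0 (k + 3) j → ω (k + 5) i j = 0) →
    (∀ k, k + 5 ≤ n + 3 → ∀ i j, starRingEnd ℂ (ω (k + 5) i j) = ω (k + 5) i j) →
    (∀ k, k + 5 ≤ n + 3 → ∀ i j, ‖ω (k + 5) i j‖ ≤ ((B (k + 5) : ℚ) : ℝ)) →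
    (∀ k, k + 5 ≤ n + 3 → ((ω (k + 5)).trace).re ≤ ((B (k + 5) : ℚ) : ℝ)) →
    ((lo : ℚ) : ℝ) ≤ ((toSpin ((U : ℂ) • (nAt (-unitVec 0) neg_unitVec_mem_chainWindow_two 0 *
          nAt (-unitVec 0) neg_unitVec_mem_chainWindow_two 1) +
        (-((1 : ℝ) : ℂ)) • ∑ σ : Fin 2,
          ((cAt (-unitVec 0) neg_unitVec_mem_chainWindow_two σ)ᴴ * cAt 0 zero_mem_chainWindow_two σ.rev +
            (cAt 0 zero_mem_chainWindow_two σ.rev)ᴴ * cAt (-unitVec 0) neg_unitVec_mem_chainWindow_two σ)) * ρ₄).trace).re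

end Nodes

/-! ## §C  Solver-free edges -/

section Edges

variable {U : ℝ} {n D : ℕ} {A : Fin 4 → Matrix (Fin D) (Fin D) ℚ} {qb : ℕ → Fin D → ℤ} {cm : ℤ} {B : ℕ → ℚ} {ν lo lo' : ℚ}

/-- A node survives a SMALLER slot `lo' ≤ lo`. -/
theorem MPSChainKSDNRaw4TrNodeSz.mono (h : MPSChainKSDNRaw4TrNodeSz U n D A qb cm B ν lo) (hlo : lo' ≤ lo) :
    MPSChainKSDNRaw4TrNodeSz U n D A qb cm B ν lo' :=
  fun ρ₄ ω h1 h2 h3 h4 h5 h6 h7 h8 h9 h10 h11 h12 h13 h14 h15 h16 =>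
    le_trans (by exact_mod_cast hlo) (h ρ₄ ω h1 h2 h3 h4 h5 h6 h7 h8 h9 h10 h11 h12 h13 h14 h15 h16)

/-- Charge covariance of the cast tensor for the staggered charge from the RATIONAL check on the table `A`. -/
theorem mpsCovSz_of_rat (hAcov : ∀ x s a b, A s a b ≠ 0 → qb (x + 1) b = qb x a + hubbardSzQeff cm x s) :
    ∀ x s a b, castTensor A s a b ≠ 0 → qb (x + 1) b = qb x a + hubbardSzQeff cm x s :=
  fun x s a b h => hAcov x s a b ((castTensor_apply_ne_zero_iff A s a b).1 h)

/-- **THE RAWLOW-`S̃z` EDGE BY NAME: a `jw-srot` `mps-rawlow` (`ρ₄`, one staggered charge, N-FREE) certificate is a `jw-srot` window certificate with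
staggered sectors** (`N = n + 3 ≥ 5`): under the side conditions (site-indexed charge covariance of `A`; the `lmax_psd` rule `W_{m−2}ᴴW_{m−2} ≤ (B m)·𝟙`,
`0 ≤ B m`, m = 5…N, over `ℂ` for `castTensor A`), `MPSChainKSDNRaw4TrNodeSz U n D A qb cm B ν lo → LTIChainKSDNNodeSrotNszb U n ν lo`. Solver-free:
KSDN's feasible point with site-indexed sectors (`Transport.ksdnSrotNszbClaim_of_mpsRaw4SrotSzTrClaim`). [cite: KullEtAl2024, §3.3, §4.2] -/
theorem MPSChainKSDNRaw4TrNodeSz.ltiChainKSDNNodeSrotNszb (h : MPSChainKSDNRaw4TrNodeSz U n D A qb cm B ν lo) (hn : 2 ≤ n)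
    (hAcov : ∀ x s a b, A s a b ≠ 0 → qb (x + 1) b = qb x a + hubbardSzQeff cm x s)
    (hB : ∀ k, k + 5 ≤ n + 3 → 0 ≤ ((B (k + 5) : ℚ) : ℝ) ∧
      (cgMap (castTensor A) (k + 3))ᴴ * cgMap (castTensor A) (k + 3) ≤
        ((B (k + 5) : ℚ) : ℝ) • (1 : Matrix (Fin (k + 3) → Fin 4) (Fin (k + 3) → Fin 4) ℂ)) :
    LTIChainKSDNNodeSrotNszb U n ν lo :=
  ksdnSrotNszbClaim_of_mpsRaw4SrotSzTrClaim 1 U n hn (castTensor A) (star_castTensor_apply A) (hubbardSzQeff cm) qb cm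
    (fun _ _ => rfl) (mpsCovSz_of_rat hAcov) (fun m => ((B m : ℚ) : ℝ)) hB chainWindowFourEquiv chainWindowFourEquiv_coord h

/-- **`jw-srot` `mps-rawlow` one-label `S̃z` certificate ⇒ standard `lti(N)` certificate** (composite edge through `LTIChainKSDNNodeSrotNszb`, whose occupation
row is unused and whose staggered row the standard node discharges by the sublattice spin rotation). [cite: KullEtAl2024, §4.2, §VI.B] -/
theorem MPSChainKSDNRaw4TrNodeSz.ltiChainKSDNNode (h : MPSChainKSDNRaw4TrNodeSz U n D A qb cm B ν lo) (hn : 2 ≤ n)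
    (hAcov : ∀ x s a b, A s a b ≠ 0 → qb (x + 1) b = qb x a + hubbardSzQeff cm x s)
    (hB : ∀ k, k + 5 ≤ n + 3 → 0 ≤ ((B (k + 5) : ℚ) : ℝ) ∧
      (cgMap (castTensor A) (k + 3))ᴴ * cgMap (castTensor A) (k + 3) ≤
        ((B (k + 5) : ℚ) : ℝ) • (1 : Matrix (Fin (k + 3) → Fin 4) (Fin (k + 3) → Fin 4) ℂ)) :
    LTIChainKSDNNode U n ν lo :=
  (h.ltiChainKSDNNodeSrotNszb hn hAcov hB).ltiChainKSDNNode

end Edges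

/-! ## §D  The M1 cells BY NAME -/

section Cells

variable {U : ℝ} {n D : ℕ} {A : Fin 4 → Matrix (Fin D) (Fin D) ℚ} {qb : ℕ → Fin D → ℤ} {cm : ℤ} {B : ℕ → ℚ} {ν lo : ℚ} {p q : ℕ}

/-- **M1 cell BY NAME** (`ν = 1`, `U ≥ 0`): a `jw-srot` rawlow one-label `S̃z` node at half filling ⇒ `lo ≤ e₀(U)` (`M1EnergyLowerRow U lo`). -/
theorem MPSChainKSDNRaw4TrNodeSz.m1EnergyLowerRow (h : MPSChainKSDNRaw4TrNodeSz U n D A qb cm B 1 lo) (hn : 2 ≤ n) (hU : 0 ≤ U)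
    (hAcov : ∀ x s a b, A s a b ≠ 0 → qb (x + 1) b = qb x a + hubbardSzQeff cm x s)
    (hB : ∀ k, k + 5 ≤ n + 3 → 0 ≤ ((B (k + 5) : ℚ) : ℝ) ∧
      (cgMap (castTensor A) (k + 3))ᴴ * cgMap (castTensor A) (k + 3) ≤
        ((B (k + 5) : ℚ) : ℝ) • (1 : Matrix (Fin (k + 3) → Fin 4) (Fin (k + 3) → Fin 4) ℂ)) :
    M1EnergyLowerRow U lo :=
  (h.ltiChainKSDNNodeSrotNszb hn hAcov hB).m1EnergyLowerRow hU

/-- **M1 doped cell BY NAME** (`ν = p/q`, `1 ≤ q`, `p ≤ 2q`, `U ≥ 0`): `lo ≤ e₀(U, n = p/q)` (`M1DopedEnergyLowerRow U p q lo`). -/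
theorem MPSChainKSDNRaw4TrNodeSz.m1DopedEnergyLowerRow (h : MPSChainKSDNRaw4TrNodeSz U n D A qb cm B ν lo) (hn : 2 ≤ n)
    (hU : 0 ≤ U) (hq : 1 ≤ q) (hp : p ≤ 2 * q) (hν : ((ν : ℚ) : ℝ) = (p : ℝ) / (q : ℝ))
    (hAcov : ∀ x s a b, A s a b ≠ 0 → qb (x + 1) b = qb x a + hubbardSzQeff cm x s)
    (hB : ∀ k, k + 5 ≤ n + 3 → 0 ≤ ((B (k + 5) : ℚ) : ℝ) ∧
      (cgMap (castTensor A) (k + 3))ᴴ * cgMap (castTensor A) (k + 3) ≤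
        ((B (k + 5) : ℚ) : ℝ) • (1 : Matrix (Fin (k + 3) → Fin 4) (Fin (k + 3) → Fin 4) ℂ)) :
    M1DopedEnergyLowerRow U p q lo :=
  (h.ltiChainKSDNNodeSrotNszb hn hAcov hB).m1DopedEnergyLowerRow hU hq hp hν

end Cells

end Summit.Ventures.CertifiedManyBodySolver

end
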